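import Mathlib

/-!
# The splitting `L ⊗[K] F ≃ₐ[L] ∏_{σ : F → L} L` over a field containing the embeddings

Blind cell `pub-hodge-repro2`, seat p7 (gen 10), A1 annex (route/T4-A1-p7.md, (A0.4) / Lemma A1.3;
route/LEAN-ANNEX-p7.md §4, the «ℂ → finite-Galois-`L` reduction»).  `A1TensorSplitting`
(p392690) proved `ℂ ⊗[ℚ] F ≃ₐ[ℂ] ((F →ₐ[ℚ] ℂ) → ℂ)` for a number field `F`.  Galois descent
(`A1GaloisDescentSubspace`, `A1SplitSummandDescent`) needs the same splitting over a FINITE Galois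
extension `L/K`; for a Galois CM field `F` the natural choice is `L = F` itself.  This file gives
the splitting over an arbitrary field `L ⊇ K`, in the form

* `ev : L ⊗[K] F →ₐ[L] ((F →ₐ[K] L) → L)`, `c ⊗ x ↦ (σ ↦ c · σ x)`;
* `ev_surjective` — always (Dedekind's independence of the embeddings);
* `tensorEquiv` — an isomorphism as soon as `#(F →ₐ[K] L) = [F : K]` (dimension count);
* `card_algHom_self` / `tensorEquivSelf` — for `F/K` finite Galois and `L = F`:
  `#(F →ₐ[K] F) = [F : K]` (Mathlib's `AlgHom.card_of_splits` + `Normal.splits`) and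
  `F ⊗[K] F ≃ₐ[F] ((F →ₐ[K] F) → F)`;
* `tensorEquivGal` — the same indexed by the Galois group, `F ⊗[K] F ≃ₐ[F] (Gal(F/K) → F)`.

What stays prose (A1 §4): the identification of `H¹(B, ℚ) ⊗ L` with an `(L ⊗[K] F)`-module
(geometry); the eigenline decomposition of such a module is `A1EigenlineDecomposition` (over `ℂ`)
and its general-`L` form is the next target.

README §8(d): uses an L-value-free non-vanishing device: NO.
-/

namespace Summit.Ventures.HodgeRepro2.A1GaloisTensorSplitting

open TensorProduct

section Ev

variable (K L F : Type*) [Field K] [Field L] [Algebra K L] [Field F] [Algebra K F]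

/-- The `K`-embeddings `F → L`. -/
abbrev Emb := F →ₐ[K] L

/-- `x ↦ (σ ↦ σ x)`, as a `K`-algebra map `F → ∏_σ L`. -/
noncomputable def evK : F →ₐ[K] (Emb K L F → L) := AlgHom.pi (fun σ : Emb K L F => σ)

/-- `evK x σ = σ x`. -/
@[simp] theorem evK_apply (x : F) (σ : Emb K L F) : evK K L F x σ = σ x :=
  AlgHom.pi_apply _ _ _

/-- The `L`-algebra map `L ⊗[K] F → ∏_σ L`, `c ⊗ x ↦ (σ ↦ c · σ x)` (the base change of `evK`). -/
noncomputable def ev : L ⊗[K] F →ₐ[L] (Emb K L F → L) :=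
  Algebra.TensorProduct.lift (Algebra.ofId L _) (evK K L F) (fun _ _ => Commute.all _ _)

/-- `ev (c ⊗ x) = (σ ↦ c * σ x)`. -/
theorem ev_tmul (c : L) (x : F) : ev K L F (c ⊗ₜ[K] x) = fun σ => c * σ x := by
  ext σ
  simp [ev, Algebra.TensorProduct.lift_tmul, Algebra.ofId_apply, Pi.algebraMap_apply]

/-- `ev (1 ⊗ x) = (σ ↦ σ x)`. -/
theorem ev_one_tmul (x : F) : ev K L F ((1 : L) ⊗ₜ[K] x) = fun σ => σ x := by
  rw [ev_tmul]
  ext σ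
  simp

/-- **Dedekind.** The embeddings `F → L`, as functions, are `L`-linearly independent. -/
theorem linearIndependent_emb :
    LinearIndependent L (fun σ : Emb K L F => (σ : F → L)) :=
  (linearIndependent_monoidHom F L).comp (fun σ : Emb K L F => (σ : F →* L))
    AlgHom.coe_monoidHom_injective

/-- **`ev` is surjective** (for any field `L ⊇ K`): a linear form on `∏_σ L` vanishing on the
range of `ev` has coefficients `d σ` with `∑_σ d σ • σ = 0`, so `d = 0` by Dedekind. -/
theorem ev_surjective [Finite (Emb K L F)] : Function.Surjective (ev K L F) := by
  classical
  cases nonempty_fintype (Emb K L F)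
  change Function.Surjective (ev K L F).toLinearMap
  rw [← LinearMap.range_eq_top]
  by_contra h
  obtain ⟨φ, hφ0, hφ⟩ := Submodule.exists_le_ker_of_lt_top _ (lt_top_iff_ne_top.mpr h)
  apply hφ0
  -- the coefficients of `φ`
  set d : Emb K L F → L := fun σ => φ (fun j => if σ = j then 1 else 0) with hd
  have hsum : ∀ x : F, ∑ σ, d σ • σ x = 0 := fun x => by
    have hx : φ (ev K L F ((1 : L) ⊗ₜ[K] x)) = 0 := hφ ⟨(1 : L) ⊗ₜ[K] x, rfl⟩
    rw [ev_one_tmul, LinearMap.pi_apply_eq_sum_univ] at hx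
    simpa [hd, mul_comm] using hx
  have hzero : ∀ σ, d σ = 0 := by
    have hli := Fintype.linearIndependent_iff.mp (linearIndependent_emb K L F) d
    refine hli ?_
    ext x
    simpa using hsum x
  refine LinearMap.pi_ext fun σ c => ?_
  have : Pi.single σ c = c • (fun j => if σ = j then (1 : L) else 0) := by
    ext j
    by_cases hj : σ = j
    · subst hj; simp
    · simp [hj, eq_comm (a := j)]
  rw [this, map_smul, LinearMap.zero_apply]
  have := hzero σ
  rw [hd] at this
  simp only at this
  rw [this, smul_zero]

end Ev

section Equiv

variable (K L F : Type*) [Field K] [Field L] [Algebra K L] [Field F] [Algebra K F]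
  [FiniteDimensional K F]

/-- `dim_L (L ⊗[K] F) = [F : K]`. -/
theorem finrank_tensor : Module.finrank L (L ⊗[K] F) = Module.finrank K F :=
  Module.finrank_baseChange

/-- **`ev` is bijective** as soon as `#(F →ₐ[K] L) = [F : K]` (surjectivity + dimension count). -/
theorem ev_bijective [Fintype (Emb K L F)]
    (hcard : Fintype.card (Emb K L F) = Module.finrank K F) :
    Function.Bijective (ev K L F) := by
  have hsurj := ev_surjective K L F
  refine ⟨?_, hsurj⟩
  have hrank : Module.finrank L (L ⊗[K] F) = Module.finrank L (Emb K L F → L) := by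
    rw [finrank_tensor, Module.finrank_fintype_fun_eq_card, hcard]
  exact (LinearMap.injective_iff_surjective_of_finrank_eq_finrank (f := (ev K L F).toLinearMap)
    hrank).mpr hsurj

/-- **The splitting `L ⊗[K] F ≃ₐ[L] ∏_{σ : F → L} L`** for a field `L ⊇ K` receiving all
`[F : K]` embeddings of `F`. -/
noncomputable def tensorEquiv [Fintype (Emb K L F)]
    (hcard : Fintype.card (Emb K L F) = Module.finrank K F) :
    L ⊗[K] F ≃ₐ[L] (Emb K L F → L) :=
  AlgEquiv.ofBijective (ev K L F) (ev_bijective K L F hcard)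

/-- `tensorEquiv (c ⊗ x) = (σ ↦ c * σ x)`. -/
theorem tensorEquiv_tmul [Fintype (Emb K L F)]
    (hcard : Fintype.card (Emb K L F) = Module.finrank K F) (c : L) (x : F) :
    tensorEquiv K L F hcard (c ⊗ₜ[K] x) = fun σ => c * σ x :=
  ev_tmul K L F c x

end Equiv

section Galois

variable (K F : Type*) [Field K] [Field F] [Algebra K F] [FiniteDimensional K F] [IsGalois K F]

/-- For `F/K` finite Galois, `F` receives all `[F : K]` embeddings of itself:
`#(F →ₐ[K] F) = [F : K]` (`AlgHom.card_of_splits`, the minimal polynomials split in `F` by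
normality). -/
theorem card_algHom_self : Fintype.card (F →ₐ[K] F) = Module.finrank K F :=
  AlgHom.card_of_splits K F F (fun x => Normal.splits inferInstance x)

/-- **The splitting over the Galois field itself**: `F ⊗[K] F ≃ₐ[F] ∏_{σ : F → F} F` — the
finite-Galois-`L` form (with `L = F`) of (A0.4)'s `F ⊗ ℂ ≅ ∏_σ ℂ`. -/
noncomputable def tensorEquivSelf : F ⊗[K] F ≃ₐ[F] (Emb K F F → F) :=
  tensorEquiv K F F (card_algHom_self K F)

/-- `tensorEquivSelf (c ⊗ x) = (σ ↦ c * σ x)`. -/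
theorem tensorEquivSelf_tmul (c x : F) :
    tensorEquivSelf K F (c ⊗ₜ[K] x) = fun σ => c * σ x :=
  ev_tmul K F F c x

/-- The same splitting indexed by the Galois group: `F ⊗[K] F ≃ₐ[F] (Gal(F/K) → F)`,
`c ⊗ x ↦ (τ ↦ c * τ x)` (`algEquivEquivAlgHom` identifies `Gal(F/K)` with `F →ₐ[K] F`). -/
noncomputable def tensorEquivGal : F ⊗[K] F ≃ₐ[F] ((F ≃ₐ[K] F) → F) :=
  (tensorEquivSelf K F).trans
    (AlgEquiv.piCongrLeft F (fun _ => F) (algEquivEquivAlgHom K F).toEquiv.symm)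

/-- `tensorEquivGal (c ⊗ x) = (τ ↦ c * τ x)`. -/
theorem tensorEquivGal_tmul (c x : F) (τ : F ≃ₐ[K] F) :
    tensorEquivGal K F (c ⊗ₜ[K] x) τ = c * τ x := by
  simp [tensorEquivGal, tensorEquivSelf_tmul, AlgEquiv.piCongrLeft]

end Galois

end Summit.Ventures.HodgeRepro2.A1GaloisTensorSplitting
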